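import Summits.MatrixMultiplication.OmegaCensus.TriangleTorusLadder

/-!
# Triangle factors of a punctured SHEARED torus: the column ladder (kernel)

ω-census `pub-omega`, family (b3), seat pub-omega-group gen 34.  Framing: lottery ticket; floor = certified bounds/negative
ranges.  VALUE: kernel infrastructure generalising the cell's Theorem B (`TriangleTorusImbalance`: in every partition of the
punctured square torus `ℤ_n² ∖ {0}`, `3 ∤ n`, into translates of `{0,e₁,e₂}` / `{0,−e₁,−e₂}`, `3·|#up − #down| ≤ 4n + 2`) from the
square torus to an ARBITRARY two-generated torus `ℤ² / ⟨(a, s), (0, n)⟩` with one hole per fundamental domain; NOT progress on ω.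
The point (HOME/pub-omega-group-g33/HANDOFF.md, 'What is left' (ii)): a part `W = {w, w+u, w+v}` of size `3` in a cube symmetric
form over ANY finite abelian group `A` gives, via `(c, j) ↦ c•u + j•v`, a triangle factor of such a sheared torus with
`n = ord v`, and the imbalance bound then forces `|A| ≤ 12·ord v + 7` (sequel files `TriangleTorusShearedImbalance`,
`ThreeSetNoPartThreeGeneral`).

* `ShearedFactor n a s` — Boolean tile indicators `up`, `dn` on `ℤ²`, `n`-periodic in the height and invariant under the
  translation `(a, s)`, a Boolean hole indicator `hole` whose holes lie in the columns `c ≡ 0 (mod a)` (`hole_col`) with at most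
  one hole per period of a column (`hole_uniq`), and the six-candidate covering axiom `cover` (every non-hole point lies in exactly
  one of its six candidate tiles, a hole in none).  `TriangleTorusLadder.TriangleFactor n` is the case `a = n`, `s = 0`, holes `nℤ²`.
* The detoured zigzags `Ẑ_c` as slot sequences (`f0`, `f1`, `slot`), the pieces `outPiece` / `inPiece`, runs `OutL` / `InL`,
  charges `charge` / `kc`, block boundaries `bdry` — VERBATIM the definitions of `TriangleTorusLadder` (they only read `up`, `dn`).
* **`ladder`**, **`ladder_hole_run`** — the one-dimensional van Kampen lemma along a hole-free run of a column, and through a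
  hole: the proofs of `TriangleTorusLadder` go through unchanged, since they use the covering axiom only locally (the hole set
  never enters except as 'this cell is / is not a hole').
-/

namespace Summit.MatrixMultiplication.OmegaCensus.TriangleTorus

/-- A triangle factor of the punctured sheared torus `ℤ² / ⟨(a,s), (0,n)⟩`, lifted to `ℤ²`: `up c j` (`dn c j`) records whether
the up-triangle `{(c,j),(c+1,j),(c,j+1)}` (down-triangle `{(c,j),(c−1,j),(c,j−1)}`) is a tile, `hole c j` whether `(c, j)` is a
hole; the data are `n`-periodic in `j` and invariant under `(c, j) ↦ (c + a, j + s)`; holes occur only in columns divisible by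
`a`, at most once per period of a column; the tiles partition the non-hole points. [folklore] -/
structure ShearedFactor (n a : ℕ) (s : ℤ) where
  /-- indicator of the up-tile anchored at `(c, j)` -/
  up : ℤ → ℤ → Bool
  /-- indicator of the down-tile anchored at `(c, j)` -/
  dn : ℤ → ℤ → Bool
  /-- indicator of the hole points -/
  hole : ℤ → ℤ → Bool
  /-- periodicity in the height -/
  up_add_right : ∀ c j, up c (j + n) = up c j
  /-- periodicity in the height -/
  dn_add_right : ∀ c j, dn c (j + n) = dn c j
  /-- invariance under the second period `(a, s)` -/
  up_add_left : ∀ c j, up (c + a) (j + s) = up c j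
  /-- invariance under the second period `(a, s)` -/
  dn_add_left : ∀ c j, dn (c + a) (j + s) = dn c j
  /-- holes lie in the columns `≡ 0 (mod a)` -/
  hole_col : ∀ c j, hole c j = true → (a : ℤ) ∣ c
  /-- at most one hole per period of a column -/
  hole_uniq : ∀ c j j', hole c j = true → hole c j' = true → (n : ℤ) ∣ j' - j
  /-- every point is in exactly one of its six candidate tiles, except the hole points, which are in none -/
  cover : ∀ c j, (up c j).toNat + (up (c - 1) j).toNat + (up c (j - 1)).toNat + (dn c j).toNat + (dn (c + 1) j).toNat +
      (dn c (j + 1)).toNat = if hole c j = true then 0 else 1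

namespace ShearedFactor

variable {n a : ℕ} {s : ℤ}

/-! ## Pieces of the detoured zigzags (as in `TriangleTorusLadder`) -/

/-- Slot `2j` of the detoured zigzag `Ẑ_c`: the edge `D(c+1,j) → U(c,j)`, or its detour. [folklore] -/
def f0 (T : ShearedFactor n a s) (c j : ℤ) : List (ℤ × ℤ) :=
  if T.up c j then [-sV (c + 1) (j - 1), sD (c + 1) (j - 1)]
  else if T.dn (c + 1) j then [sD (c - 1) j, -sV c j]
  else [-sH c j]

/-- Slot `2j+1` of `Ẑ_c`: the edge `U(c,j) → D(c+1,j+1)`, or its detour. [folklore] -/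
def f1 (T : ShearedFactor n a s) (c j : ℤ) : List (ℤ × ℤ) :=
  if T.up c j then [-sH (c + 1) j, sV (c + 1) j]
  else if T.dn (c + 1) (j + 1) then [sV c j, -sH (c - 1) (j + 1)]
  else [sD c j]

/-- The slot sequence of `Ẑ_c`. [folklore] -/
def slot (T : ShearedFactor n a s) (c k : ℤ) : List (ℤ × ℤ) := if k % 2 = 0 then T.f0 c (k / 2) else T.f1 c (k / 2)

/-- Slot `2j − 1` of `Ẑ_c`, re-indexed by `j` (= `f1 c (j−1)`). [folklore] -/
def fout1 (T : ShearedFactor n a s) (c j : ℤ) : List (ℤ × ℤ) :=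
  if T.up c (j - 1) then [-sH (c + 1) (j - 1), sV (c + 1) (j - 1)]
  else if T.dn (c + 1) j then [sV c (j - 1), -sH (c - 1) j]
  else [sD c (j - 1)]

/-- Slot `2j` of `Ẑ_{c−1}`, re-indexed by the column `c` (= `f0 (c−1) j`). [folklore] -/
def fin0 (T : ShearedFactor n a s) (c j : ℤ) : List (ℤ × ℤ) :=
  if T.up (c - 1) j then [-sV c (j - 1), sD c (j - 1)]
  else if T.dn c j then [sD (c - 2) j, -sV (c - 1) j]
  else [-sH (c - 1) j]

/-- Slot `2j+1` of `Ẑ_{c−1}`, re-indexed by the column `c` (= `f1 (c−1) j`). [folklore] -/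
def fin1 (T : ShearedFactor n a s) (c j : ℤ) : List (ℤ × ℤ) :=
  if T.up (c - 1) j then [-sH c j, sV c j]
  else if T.dn c (j + 1) then [sV (c - 1) j, -sH (c - 2) (j + 1)]
  else [sD (c - 1) j]

/-- The OUT-piece of cell `j` of column `c`: slots `2j−1, 2j` of `Ẑ_c` (from `U(c,j−1)` to `U(c,j)`). [folklore] -/
def outPiece (T : ShearedFactor n a s) (c j : ℤ) : List (ℤ × ℤ) := T.fout1 c j ++ T.f0 c j

/-- The IN-piece of cell `j` of column `c`: slots `2j, 2j+1` of `Ẑ_{c−1}` (from `D(c,j)` to `D(c,j+1)`). [folklore] -/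
def inPiece (T : ShearedFactor n a s) (c j : ℤ) : List (ℤ × ℤ) := T.fin0 c j ++ T.fin1 c j

/-- [folklore] -/
theorem fout1_eq (T : ShearedFactor n a s) (c j : ℤ) : T.fout1 c j = T.f1 c (j - 1) := by
  simp only [fout1, f1, sub_add_cancel]

/-- [folklore] -/
theorem fin0_eq (T : ShearedFactor n a s) (c j : ℤ) : T.fin0 c j = T.f0 (c - 1) j := by
  simp only [fin0, f0, sub_add_cancel, sub_sub, one_add_one_eq_two]

/-- [folklore] -/
theorem fin1_eq (T : ShearedFactor n a s) (c j : ℤ) : T.fin1 c j = T.f1 (c - 1) j := by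
  simp only [fin1, f1, sub_add_cancel, sub_sub, one_add_one_eq_two]

/-- [folklore] -/
theorem slot_even (T : ShearedFactor n a s) (c j : ℤ) : T.slot c (2 * j) = T.f0 c j := by
  have h1 : (2 * j) % 2 = 0 := by omega
  have h2 : (2 * j) / 2 = j := by omega
  simp only [slot, h1, h2, if_true]

/-- [folklore] -/
theorem slot_odd (T : ShearedFactor n a s) (c j : ℤ) : T.slot c (2 * j + 1) = T.f1 c j := by
  have h1 : (2 * j + 1) % 2 = 1 := by omega
  have h2 : (2 * j + 1) / 2 = j := by omega
  simp only [slot, h1, h2]; simp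

/-- [folklore] -/
theorem outPiece_eq_slots (T : ShearedFactor n a s) (c j : ℤ) : T.outPiece c j = T.slot c (2 * j + (-1)) ++ T.slot c (2 * j + (-1) + 1) := by
  rw [outPiece, fout1_eq, show 2 * j + (-1) = 2 * (j - 1) + 1 by ring, slot_odd,
    show 2 * (j - 1) + 1 + 1 = 2 * j by ring, slot_even]

/-- [folklore] -/
theorem inPiece_eq_slots (T : ShearedFactor n a s) (c j : ℤ) : T.inPiece c j = T.slot (c - 1) (2 * j + 0) ++ T.slot (c - 1) (2 * j + 0 + 1) := by
  rw [inPiece, fin0_eq, fin1_eq, add_zero, slot_even, slot_odd]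

/-- The run of OUT-pieces of the cells `lo, …, lo+m−1` of column `c`. [folklore] -/
def OutL (T : ShearedFactor n a s) (c lo : ℤ) (m : ℕ) : List (ℤ × ℤ) := lconcat (T.outPiece c) lo m

/-- The run of IN-pieces of the cells `lo, …, lo+m−1` of column `c`. [folklore] -/
def InL (T : ShearedFactor n a s) (c lo : ℤ) (m : ℕ) : List (ℤ × ℤ) := lconcat (T.inPiece c) lo m

/-- The central charge of cell `j` of column `c`: `+18` for the anchor of an up-tile of the strip, `−18` for a down-tile.
[folklore] -/
def charge (T : ShearedFactor n a s) (c j : ℤ) : ℤ := (if T.up c j then 18 else 0) - (if T.dn c j then 18 else 0)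

/-- Total charge of the cells `lo, …, lo+m−1` of column `c`. [folklore] -/
def kc (T : ShearedFactor n a s) (c lo : ℤ) : ℕ → ℤ
  | 0 => 0
  | m + 1 => kc T c lo m + T.charge c (lo + m)

/-- A block boundary below cell `k` of column `c`: no domino of column `c` occupies both cells `k−1`, `k`. [folklore] -/
def bdry (T : ShearedFactor n a s) (c k : ℤ) : Prop := T.up c (k - 1) = false ∧ T.dn c k = false

/-! ## The ladder -/

/-- **The ladder lemma** on a sheared torus (one-dimensional van Kampen along a column).  For a hole-free run of cells
`lo, …, lo+m−1` of column `c` between block boundaries, the OUT-run followed by the top rung has the same holonomy as the bottom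
rung followed by the IN-run, up to the central charge `kc`.  (Proof verbatim as in `TriangleFactor.ladder`.) [folklore] -/
theorem ladder (T : ShearedFactor n a s) (c : ℤ) : ∀ (m : ℕ) (lo : ℤ), T.bdry c lo → T.bdry c (lo + m) →
    (∀ i : ℕ, i < m → T.hole c (lo + i) = false) →
    hol (T.OutL c lo m) * st (sV c (lo + m - 1)) = st (sV c (lo - 1)) * hol (T.InL c lo m) * cen (T.kc c lo m) := by
  intro m
  induction m using Nat.strongRecOn with
  | ind m ih =>
    intro lo hlo hhi hnh
    rcases m with _ | m
    · simp [OutL, InL, kc]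
    -- top cell k = lo + m
    set k : ℤ := lo + m with hk
    have ek : (lo + ((m + 1 : ℕ) : ℤ)) = k + 1 := by push_cast; omega
    rw [ek] at hhi
    obtain ⟨hb1, hb2⟩ := hhi
    rw [add_sub_cancel_right] at hb1
    have hkh : ¬ T.hole c k = true := by simpa using hnh m (Nat.lt_succ_self m)
    obtain ⟨-, -, h2, h3, h4, h5, -, hsome⟩ := six_cases (T.cover c k)
    -- split the runs at the last cell
    have eO : T.OutL c lo (m + 1) = T.OutL c lo m ++ T.outPiece c k := rfl
    have eI : T.InL c lo (m + 1) = T.InL c lo m ++ T.inPiece c k := rfl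
    have eK : T.kc c lo (m + 1) = T.kc c lo m + T.charge c k := rfl
    rw [eO, eI, eK, hol_append, hol_append, ek, add_sub_cancel_right]
    rcases hsome hkh with h | h | h | h | h | h
    · exact absurd h (by simp [hb1])
    · -- `a`-cell: covered by the up-tile U(c-1, k)
      obtain ⟨-, hut, hdt, hb, hdb⟩ := h2 h
      have hbk : T.bdry c k := ⟨hut, hdt⟩
      have IH := ih m (Nat.lt_succ_self m) lo hlo hbk fun i hi => hnh i (Nat.lt_succ_of_lt hi)
      rw [show lo + (m : ℤ) - 1 = k - 1 by omega] at IH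
      refine TriangleFactor.ladder_alg IH ?_
      simp only [outPiece, inPiece, fout1, f0, fin0, fin1, charge, h, hb1, hut, hdt, hb, hdb, if_true, if_false,
        Bool.false_eq_true, List.cons_append, List.nil_append, hol_cons, hol_nil, sub_self, cen_zero, mul_one]
      simp only [sD, sV, sH, tw_eq]
      push_cast
      generalize (c : ZMod 3) = a
      generalize (k : ZMod 3) = b
      revert a b
      decide
    · -- top cell of an up-domino U(c, k-1): the block is {k-1, k}
      rcases m with _ | m
      · -- impossible: k = lo and the boundary below lo forbids U(c, lo-1)
        have : k = lo := by rw [hk]; push_cast; ring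
        rw [this] at h; exact absurd h (by simp [hlo.1])
      set k' : ℤ := lo + m with hk'
      have ekk : k = k' + 1 := by rw [hk, hk']; push_cast; ring
      rw [ekk] at h hb1 hb2 hkh h3 ⊢
      have h' : T.up c k' = true := by simpa using h
      obtain ⟨-, h1', -, -, -, -, -, -⟩ := six_cases (T.cover c k')
      obtain ⟨ha', hut', hdt', hb', hdb'⟩ := h1' h'
      obtain ⟨hu, ha, -, hb, hdb⟩ := h3 h
      have hbk : T.bdry c k' := ⟨hut', hdt'⟩
      have IH := ih m (by omega) lo hlo hbk fun i hi => hnh i (by omega)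
      rw [show lo + (m : ℤ) - 1 = k' - 1 by omega] at IH
      have eO : T.OutL c lo (m + 1) = T.OutL c lo m ++ T.outPiece c k' := rfl
      have eI : T.InL c lo (m + 1) = T.InL c lo m ++ T.inPiece c k' := rfl
      have eK : T.kc c lo (m + 1) = T.kc c lo m + T.charge c k' := rfl
      rw [eO, eI, eK, hol_append, hol_append, mul_assoc (hol (T.OutL c lo m)),
        ← hol_append (T.outPiece c k') (T.outPiece c (k' + 1)), mul_assoc (hol (T.InL c lo m)),
        ← hol_append (T.inPiece c k') (T.inPiece c (k' + 1)), add_assoc (T.kc c lo m)]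
      refine TriangleFactor.ladder_alg IH ?_
      simp only [outPiece, inPiece, fout1, f0, fin0, fin1, charge, add_sub_cancel_right, h', ha', hut', hdt', hb', hdb',
        hu, ha, hb, hdb, if_true, if_false, Bool.false_eq_true, List.cons_append, List.nil_append, hol_cons, hol_nil,
        mul_one, sub_zero, sub_self, add_zero]
      simp only [sD, sV, sH, tw_eq]
      push_cast
      generalize (c : ZMod 3) = a
      generalize (k' : ZMod 3) = b
      revert a b
      decide
    · -- top cell of a down-domino D(c, k): the block is {k-1, k}
      rcases m with _ | m
      · have : k = lo := by rw [hk]; push_cast; ring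
        rw [this] at h; exact absurd h (by simp [hlo.2])
      set k' : ℤ := lo + m with hk'
      have ekk : k = k' + 1 := by rw [hk, hk']; push_cast; ring
      rw [ekk] at h hb1 hb2 hkh h4 ⊢
      obtain ⟨-, -, -, -, -, -, h6', -⟩ := six_cases (T.cover c k')
      obtain ⟨hu', ha', hut', hdt', hb'⟩ := h6' h
      obtain ⟨hu, ha, -, hb, hdb⟩ := h4 h
      have hbk : T.bdry c k' := ⟨hut', hdt'⟩
      have IH := ih m (by omega) lo hlo hbk fun i hi => hnh i (by omega)
      rw [show lo + (m : ℤ) - 1 = k' - 1 by omega] at IH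
      have eO : T.OutL c lo (m + 1) = T.OutL c lo m ++ T.outPiece c k' := rfl
      have eI : T.InL c lo (m + 1) = T.InL c lo m ++ T.inPiece c k' := rfl
      have eK : T.kc c lo (m + 1) = T.kc c lo m + T.charge c k' := rfl
      rw [eO, eI, eK, hol_append, hol_append, mul_assoc (hol (T.OutL c lo m)),
        ← hol_append (T.outPiece c k') (T.outPiece c (k' + 1)), mul_assoc (hol (T.InL c lo m)),
        ← hol_append (T.inPiece c k') (T.inPiece c (k' + 1)), add_assoc (T.kc c lo m)]
      refine TriangleFactor.ladder_alg IH ?_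
      simp only [outPiece, inPiece, fout1, f0, fin0, fin1, charge, add_sub_cancel_right, h, hu', ha', hut', hdt', hb',
        hu, ha, hb, hdb, if_true, if_false, Bool.false_eq_true, List.cons_append, List.nil_append, hol_cons, hol_nil,
        mul_one, zero_sub, sub_self, zero_add]
      simp only [sD, sV, sH, tw_eq]
      push_cast
      generalize (c : ZMod 3) = a
      generalize (k' : ZMod 3) = b
      revert a b
      decide
    · -- `b`-cell: covered by the down-tile D(c+1, k)
      obtain ⟨-, ha, hut, hdt, hdb⟩ := h5 h
      have hbk : T.bdry c k := ⟨hut, hdt⟩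
      have IH := ih m (Nat.lt_succ_self m) lo hlo hbk fun i hi => hnh i (Nat.lt_succ_of_lt hi)
      rw [show lo + (m : ℤ) - 1 = k - 1 by omega] at IH
      refine TriangleFactor.ladder_alg IH ?_
      simp only [outPiece, inPiece, fout1, f0, fin0, fin1, charge, h, hb1, ha, hut, hdt, hdb, if_true, if_false,
        Bool.false_eq_true, List.cons_append, List.nil_append, hol_cons, hol_nil, sub_self, cen_zero, mul_one]
      simp only [sD, sV, sH, tw_eq]
      push_cast
      generalize (c : ZMod 3) = a
      generalize (k : ZMod 3) = b
      revert a b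
      decide
    · exact absurd h (by simp [hb2])

/-- Peeling off the first cell of a charge sum. [folklore] -/
theorem kc_succ' (T : ShearedFactor n a s) (c lo : ℤ) (m : ℕ) : T.kc c lo (m + 1) = T.charge c lo + T.kc c (lo + 1) m := by
  induction m with
  | zero => simp [kc]
  | succ m ih =>
    rw [show T.kc c lo (m + 1 + 1) = T.kc c lo (m + 1) + T.charge c (lo + (m + 1 : ℕ)) from rfl, ih,
      show T.kc c (lo + 1) (m + 1) = T.kc c (lo + 1) m + T.charge c (lo + 1 + m) from rfl, add_assoc]
    congr 3; push_cast; ring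

/-- **Ladder through the hole.**  For the run of cells `lo, …, lo+m` of column `c` starting AT a hole point `(c, lo)` (and
containing no other hole point), the hexagon loop around the hole appears between the bottom rung and the in-pieces.
[folklore] -/
theorem ladder_hole_run (T : ShearedFactor n a s) (c lo : ℤ) (m : ℕ) (hh : T.hole c lo = true) (hhi : T.bdry c (lo + 1 + m))
    (hnh : ∀ i : ℕ, i < m → T.hole c (lo + 1 + i) = false) :
    hol (T.OutL c lo (m + 1)) * st (sV c (lo + m)) =
      st (sV c (lo - 1)) * hol (hexLoop c lo) * hol (T.InL c lo (m + 1)) * cen (T.kc c lo (m + 1)) := by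
  obtain ⟨hP, -, -, -, -, -, -, -⟩ := six_cases (T.cover c lo)
  obtain ⟨hu, ha, hut, hdt, hb, hdb⟩ := hP.1 hh
  have hb1 : T.bdry c (lo + 1) := ⟨by simpa using hu, hdb⟩
  have L := T.ladder c m (lo + 1) hb1 hhi hnh
  rw [add_sub_cancel_right, show lo + 1 + (m : ℤ) - 1 = lo + m by ring] at L
  rw [OutL, InL, lconcat_succ', lconcat_succ', kc_succ', hol_append, hol_append, mul_assoc, ← OutL, L, ← InL]
  have loc : hol (T.outPiece c lo) * st (sV c lo) = st (sV c (lo - 1)) * hol (hexLoop c lo) * hol (T.inPiece c lo) := by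
    simp only [outPiece, inPiece, fout1, f0, fin0, fin1, hu, ha, hut, hdt, hb, hdb, if_false, Bool.false_eq_true,
      List.cons_append, List.nil_append]
    exact ladder_hole c lo
  have hch : T.charge c lo = 0 := by simp [charge, hu, hdt]
  rw [hch, zero_add, ← mul_assoc, ← mul_assoc, loc]
  simp only [mul_assoc]

end ShearedFactor

end Summit.MatrixMultiplication.OmegaCensus.TriangleTorus
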